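import Summits.QuantumFields.BalabanUV.T4Continuum.Support.ShellMeasureAverageProp4General
import Summits.QuantumFields.BalabanUV.T4Continuum.Support.ShellMeasureLandauFixedPoint

/-!
# W-a (Cf) JUNCTION INTO END-II: B7's k-fold nonlinear part `C_k(U₀, ·)` as END-II's Landau-correction binder pair
# `hCq` ∕ `hCd`, k-UNIFORM (`ShellMeasureLandauCorrectionB7`)

Audit cell `pub-balaban`, sub-cell `t4`, NE7c ROUND-2 crew seat `b2b-balaban-t4-ne7c-formalise-leaf-10` gen 9; owner table
`t4/b2b-balaban-t4-ne7c-p1/LEAVES-NE7c-P1.md` v2.7 row **S64** «W-a (Cf) JUNCTION INTO END-II» (handed over by leaf-04-g4 under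
its own rule, journal l.14907/l.14937).  INPUTS BY NAME (none restated): row S56 f3 `ShellMeasureAverageProp4General`
(`prop4_general_bounds` = [Balaban1985Averaging] Prop. 4 (130)/(131) at a general regular background, k-uniform;
`prop4_general_analyticAt`; `mlog_dbavgCovIter`; the constants `C1cov`, `O1cov`, `C2cov`, `smallness_of_bracket`), row S56
f2 `B7Prop4GeneralLevels` (`logCovIter` ∕ `linCovIter` = the composites (127), `level_regularity`,
`levelFactors_prod_le_exp`), row S55 (`ShellMeasureAverageProp3Discharge.loopReg_of_pdev`, leaf-05-g6's
`B7Prop3GeneralTild.linQcov_add ∕ linQcov_smul`, `h3lin_discharge`), b07 (`B7Prop3Flat.insCfg` — the finite insertion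
«the variables A_b, b ∈ S», `norm_insCfg_le`, `insCfg_smul`, `analyticAt_insCfg`), and END-II's side
`ShellMeasureLandauFixedPoint.quadAnalytic_of_frechet` (`B13Contraction113.QuadAnalytic`).

THE JUNCTION.  END-II (`ShellMeasureLandauHolonomyPrint.slotAC_realized_su2_landauChart_print`, and the Sect.-C scheme
`ShellMeasureLandauFixedPoint`) takes the Landau correction as an ABSTRACT map `Cf : 𝒴' → 𝒳` between complex normed spaces
with the binder PAIR `hCq : ∀ Z, ‖Z‖ < RC → ‖Cf Z‖ ≤ C₂‖Z‖²` and `hCd : DifferentiableOn ℂ Cf (ball 0 RC)` — the TYPE of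
[Balaban1985Variational] (44) «Q_j(LʲηA′) = LʲηQ_jA′ + C_j(LʲηA′), |C_j(LʲηA)| ≦ C₂(Lʲη)²|A|²», cited there as [4] = B7
Prop. 4 (complex form Prop. 7).  HERE `𝒴' := 𝔸^S` (a finite set `S` of fine bonds, sup norm — print's «variables A_b»),
`𝒳 := 𝔸^{S′}` (a finite set `S′` of `Lᵏ`-bonds), and `Cf` IS B7's `C_k(U₀, ·)` READ IN THE `A`-CURRENCY: for `A ∈ 𝔸^S` put
`U₁ = e^{ηA}` on `S` (`η = L^{−k}`, `insCfg`), `1` off `S`; then `landauCf A (c) := Q_k(U₀, ηA)(c) − LᵏηQ_k(U₀)A(c)` =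
`logCovIter k − linCovIter k` at the scaled insertion.  In this currency `Lᵏ·sup‖ηA‖ = ‖A‖`, so (135)'s `C₂(Lᵏb)²` is
`C₂‖A‖²` with `C₂ = C2cov d = 12·131072(d+1)²` and the radius `RC = landauRad d L = min(1/(24·C1cov d), c₃(d,L)/2)` —
BOTH INDEPENDENT OF `k`, of `α₀` and of the background `U₀` (hence V-uniform when `U₀` is an exterior section's datum).

WHAT THIS FILE PROVES (kernel, 0 sorry), for `L ≥ 2`, `U₀` as in Prop. 2 (`G`-valued, `AvgClosed d L G`,
`pdev U₀ < α₀L^{−2k}`, `C₀α₀ ≤ 1/3`) with `4α₀ ≤ c₂′(d,L)` and print's bracket `4·O1cov(d)·α₀ ≤ 1/3`: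
* §2 `linCovIter_add` ∕ `linCovIter_smul` ∕ `norm_linCovIter_le` — the composed linear part «LʲηQ_j(U₀)» is additive,
  `ℂ`-homogeneous and bounded by `∏_{i<j}(1 + κ_i)·Lʲ·sup‖B‖` (NO smallness on the field: (126) iterated), hence
  **`isBoundedLinearMap_landauLin`**: `A ↦ LᵏηQ_k(U₀)(ηA)|_{S′}` is a bounded linear map `𝔸^S → 𝔸^{S′}` with
  `‖·‖ ≤ (3/2)‖A‖` (k-uniform) — so it is `ℂ`-differentiable everywhere.
* §3 **`landauCorrection_binders`** — THE PAIR: `∀ A, ‖A‖ < landauRad d L → ‖landauCf A‖ ≤ C2cov d * ‖A‖ ^ 2` and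
  `DifferentiableOn ℂ landauCf (ball 0 (landauRad d L))` (`prop4_general_bounds` in the `A`-currency; `prop4_general_analyticAt`
  componentwise on `𝔸^{S′}` minus the bounded linear part); **`landauCorrection_quadAnalytic`** = B13's `QuadAnalytic` form;
  `landauCf_eq_mlog_sub` — on the ball and for `k ≥ 1`, `landauCf A (c) = (1/i) log U̿₁ᵏ(c) − LᵏηQ_k(U₀)(ηA)(c)` for the
  iterate (90)/(91) itself (`mlog_dbavgCovIter`).
WHAT IT DOES NOT DO (said, not claimed): the identification with Bałaban's SECTIONED j-fold average on `Ω_j` in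
[Balaban1985Variational] (44) is the `Lʲη`-scaling display (as row S63 (a) does for (97)) + W-c [dict] + the `Ω_j`
geometry; END-II's real-structure binder `hCr` (skew-Hermitian in ↦ skew-Hermitian out) is not treated; Prop. 7 (complex
background) is not treated.  HONEST (cell): junction bookkeeping on OUR side of WALL §2 (a); no live-level estimate of
Bałaban's is discharged; «NE7c ⇐ the named binders»; NE7c NOT PRINTED, NOT PROVED; spine PROVED 0/9; rung (B)+1 on a
FINITE T⁴ — NOT infinite volume, NOT mass gap, NOT Clay.  HONEST DEPENDENCY: continuum YM on T⁴ ⇐ BetaPertH ∧ nine spine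
estimates (0/9 proved); BetaPertH ⇐ (D1) ∧ (D4) ∧ CAP+tail; G-an2-4 gates asym, D1 and NE2/3/4.
-/

noncomputable section

open scoped BigOperators
open NormedSpace Finset Metric

namespace Summit.QuantumFields.BalabanUV.T4Continuum.ShellMeasureLandauCorrectionB7

open Literature.MathematicalPhysics.QuantumFieldTheory.Balaban1983to89
open B7Prop1Explicit B7Prop2Explicit B7Prop3Flat B7Eq92Concrete MatrixLog B7Prop3GeneralLinear
  B7Prop4GeneralInduction B7Prop4GeneralLevels
open B7Prop3GeneralTild (linQcov_add linQcov_smul)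
open B13Contraction113 (QuadAnalytic)
open Summit.QuantumFields.BalabanUV.T4Continuum.ShellMeasureAverageProp3Discharge (loopReg_of_pdev)
open Summit.QuantumFields.BalabanUV.T4Continuum.ShellMeasureAverageProp4General
open Summit.QuantumFields.BalabanUV.T4Continuum.ShellMeasureLandauFixedPoint (quadAnalytic_of_frechet)

variable {d : ℕ} {𝔸 : Type*} [NormedRing 𝔸] [NormedAlgebra ℂ 𝔸] [CompleteSpace 𝔸] [NormOneClass 𝔸]

/-! ## §1 The objects: the scaled insertion `U₁ = e^{ηA}` on `S`, the composed linear part and the correction on `S′` -/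

/-- the radius `RC` of END-II's binder pair in the `A`-currency: `min(1/(24·C1cov d), c₃(d,L)/2)` — print's «α₁ ≦ c₄(d, L)»
(the bracket «8C₁α₁ ≦ 1/3» and «α₁ ≦ ½c₃»); independent of `k`, `α₀`, `U₀`. -/
def landauRad (d L : ℕ) : ℝ := min (1 / (24 * C1cov d)) (c3 d L / 2)

/-- the scaled insertion «U₁ = e^{iηA}, the variables A_b, b ∈ S» read on the unit lattice: the bond field equal to
`L^{−k}·A_b` on the bonds of `S` and `0` elsewhere (`B7Prop3Flat.insCfg`). -/
def scaleIns (L k : ℕ) (S : Finset (B7Prop1Explicit.Site d × Fin d)) (A : S → 𝔸) : B7Prop1Explicit.Site d → Fin d → 𝔸 :=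
  insCfg S ((((L : ℂ) ^ k)⁻¹) • A)

/-- «LᵏηQ_k(U₀)A» — the composed linear part (p. 38 «Q_{j+1}(U₀) = Q(Ū₀ʲ)Q_j(U₀)», `linCovIter`) of the scaled insertion,
read on the `Lᵏ`-bonds of `S′`. -/
def landauLin (L : ℕ) (U₀ : B7Prop1Explicit.Site d → Fin d → 𝔸ˣ) (k : ℕ)
    (S S' : Finset (B7Prop1Explicit.Site d × Fin d)) (A : S → 𝔸) : S' → 𝔸 :=
  fun c => linCovIter L U₀ (scaleIns L k S A) k c.1.1 c.1.2

/-- **«C_k(U₀, A)» (134) in the `A`-currency** — `Q_k(U₀, ηA) − LᵏηQ_k(U₀)A` for the scaled insertion, read on the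
`Lᵏ`-bonds of `S′`: END-II's `Cf : 𝒴' → 𝒳` with `𝒴' = 𝔸^S`, `𝒳 = 𝔸^{S′}`. -/
def landauCf (L : ℕ) (U₀ : B7Prop1Explicit.Site d → Fin d → 𝔸ˣ) (k : ℕ)
    (S S' : Finset (B7Prop1Explicit.Site d × Fin d)) (A : S → 𝔸) : S' → 𝔸 :=
  fun c => logCovIter L U₀ (scaleIns L k S A) k c.1.1 c.1.2 - linCovIter L U₀ (scaleIns L k S A) k c.1.1 c.1.2

/-- `landauRad d L > 0` for `L ≥ 1`. [folklore] -/
theorem landauRad_pos (d : ℕ) {L : ℕ} (hL : 1 ≤ L) : 0 < landauRad d L := by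
  have := C1cov_pos d; have := c3_pos d hL
  unfold landauRad; positivity

/-- the radius delivers print's bracket: `‖A‖ ≤ landauRad` gives `8·C1cov·‖A‖ ≤ 1/3` and `2‖A‖ ≤ c₃`. [folklore] -/
theorem bracket_of_le_landauRad {L : ℕ} {t : ℝ} (ht : t ≤ landauRad d L) :
    8 * C1cov d * t ≤ 1 / 3 ∧ 2 * t ≤ c3 d L := by
  have h1 : t ≤ 1 / (24 * C1cov d) := ht.trans (min_le_left _ _)
  have h2 : t ≤ c3 d L / 2 := ht.trans (min_le_right _ _)
  have hC := C1cov_pos d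
  refine ⟨?_, by linarith⟩
  have := (le_div_iff₀ (by positivity : (0 : ℝ) < 24 * C1cov d)).1 h1
  linarith

omit [CompleteSpace 𝔸] [NormOneClass 𝔸] in
/-- the scaling: every bond variable of the scaled insertion is bounded by `L^{−k}‖A‖`, and `Lᵏ·(L^{−k}‖A‖) = ‖A‖`.
[folklore] -/
theorem norm_scaleIns_le (L k : ℕ) (S : Finset (B7Prop1Explicit.Site d × Fin d)) (A : S → 𝔸)
    (x : B7Prop1Explicit.Site d) (κ : Fin d) : ‖scaleIns L k S A x κ‖ ≤ ((L : ℝ) ^ k)⁻¹ * ‖A‖ := by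
  refine (norm_insCfg_le S _ x κ).trans ?_
  rw [norm_smul, norm_inv, norm_pow, Complex.norm_natCast]

/-- `Lᵏ·(L^{−k}·t) = t` (`L ≥ 1`). [folklore] -/
theorem pow_mul_inv_mul {L : ℕ} (hL : 1 ≤ L) (k : ℕ) (t : ℝ) : (L : ℝ) ^ k * (((L : ℝ) ^ k)⁻¹ * t) = t := by
  have hL0' : (0 : ℝ) < L := by exact_mod_cast hL
  have hL0 : (0 : ℝ) < (L : ℝ) ^ k := pow_pos hL0' k
  rw [← mul_assoc, mul_inv_cancel₀ hL0.ne', one_mul]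

omit [CompleteSpace 𝔸] [NormOneClass 𝔸] in
/-- the scaled insertion is `ℂ`-linear in `A`. [folklore] -/
theorem scaleIns_add (L k : ℕ) (S : Finset (B7Prop1Explicit.Site d × Fin d)) (A A' : S → 𝔸) :
    scaleIns L k S (A + A') = scaleIns L k S A + scaleIns L k S A' := by
  funext x κ
  simp only [scaleIns, insCfg, smul_add, Pi.add_apply, Pi.smul_apply]
  split_ifs <;> simp

omit [CompleteSpace 𝔸] [NormOneClass 𝔸] in
/-- … and homogeneous. [folklore] -/
theorem scaleIns_smul (L k : ℕ) (S : Finset (B7Prop1Explicit.Site d × Fin d)) (t : ℂ) (A : S → 𝔸) :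
    scaleIns L k S (t • A) = t • scaleIns L k S A := by
  rw [scaleIns, scaleIns, smul_comm (((L : ℂ) ^ k)⁻¹) t A, insCfg_smul]

/-! ## §2 The composed linear part: additive, homogeneous, bounded — a bounded linear map, k-uniformly -/

section LinearPart

variable (L : ℕ) (hL : 2 ≤ L) {G : Subgroup 𝔸ˣ} (hG : AvgClosed d L G) (k : ℕ)
  (U₀ : B7Prop1Explicit.Site d → Fin d → 𝔸ˣ) (hU₀ : ∀ x κ, U₀ x κ ∈ G) {α₀ : ℝ} (hα : 0 < α₀)
  (hα3 : C0 d * α₀ ≤ 1 / 3) (hα4 : 4 * α₀ ≤ c2' d L) (h52 : pdev U₀ < α₀ * (((L : ℝ) ^ k)⁻¹) ^ 2)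

include hL hG hU₀ hα hα3 hα4 h52 in
/-- per-level data (as in `ShellMeasureAverageProp4General`): `Ū₀ʲ` is unit-bounded with plaquette deviation
`< 2α₀(Lʲ/Lᵏ)² ≤ βmax`, so its block contours at EVERY `L`-bond are within `1/64` of `1`. [folklore] -/
private theorem level_loop (j : ℕ) (hj : j ≤ k) (q : B7Prop1Explicit.Site d) (κ : Fin d) :
    (∀ x κ', avgIter L U₀ j x κ' ∈ U1 𝔸) ∧
      0 ≤ 2 * (α₀ * ((L : ℝ) ^ j * ((L : ℝ) ^ k)⁻¹) ^ 2) ∧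
      pdev (avgIter L U₀ j) < 2 * (α₀ * ((L : ℝ) ^ j * ((L : ℝ) ^ k)⁻¹) ^ 2) ∧
      2 * (α₀ * ((L : ℝ) ^ j * ((L : ℝ) ^ k)⁻¹) ^ 2) ≤ 1 / (1024 * ((d : ℝ) + 1) * ((d : ℝ) + 4) * (L : ℝ) ^ 2) ∧
      (∀ r : Fin d → Fin L, ‖((Wcx L (avgIter L U₀ j) q κ (boxVec L r) : 𝔸ˣ) : 𝔸) - 1‖ < 1) := by
  have hL1 : 1 ≤ L := le_trans (by norm_num) hL
  have hα2 : 2 * α₀ ≤ c2' d L := by linarith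
  have hreg := level_regularity L hL hG k U₀ hU₀ hα hα3 hα2 h52 j hj
  have hL1r : (1 : ℝ) ≤ L := by exact_mod_cast hL1
  have hLk : (0 : ℝ) < (L : ℝ) ^ k := by positivity
  have hratio : (L : ℝ) ^ j * ((L : ℝ) ^ k)⁻¹ ≤ 1 := by
    rw [mul_inv_le_iff₀ hLk, one_mul]; exact pow_le_pow_right₀ hL1r hj
  have h1 : ((L : ℝ) ^ j * ((L : ℝ) ^ k)⁻¹) ^ 2 ≤ 1 := by
    rw [← one_pow 2]; exact pow_le_pow_left₀ (by positivity) hratio 2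
  have hV₀ : ∀ x κ', avgIter L U₀ j x κ' ∈ U1 𝔸 := fun x κ' => hG.le_U1 (hreg.2 x κ')
  have hβmax : 2 * (α₀ * ((L : ℝ) ^ j * ((L : ℝ) ^ k)⁻¹) ^ 2)
      ≤ 1 / (1024 * ((d : ℝ) + 1) * ((d : ℝ) + 4) * (L : ℝ) ^ 2) := by
    have := two_mul_le_betaMax (d := d) hα4
    nlinarith [mul_le_mul_of_nonneg_left h1 hα.le]
  obtain ⟨hloop, hα1⟩ := loopReg_of_pdev hL1 hV₀ (by positivity) hreg.1 hβmax q κ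
  exact ⟨hV₀, by positivity, hreg.1, hβmax, fun r => ((hloop r).trans hα1).trans_lt (by norm_num)⟩

include hL hG hU₀ hα hα3 hα4 h52 in
/-- the composed linear part is ADDITIVE in the field (the one-step linear part (122) is — leaf-05-g6's `linQcov_add` —
at every level background). [cite: Balaban1985Averaging, p.38 (before (133)), (122) p.36] -/
theorem linCovIter_add (B B' : B7Prop1Explicit.Site d → Fin d → 𝔸) :
    ∀ j ≤ k, linCovIter L U₀ (B + B') j = linCovIter L U₀ B j + linCovIter L U₀ B' j := by
  intro j
  induction j with
  | zero => intro _; rfl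
  | succ j ih =>
    intro hjk
    funext z κ
    have hW := (level_loop L hL hG k U₀ hU₀ hα hα3 hα4 h52 j (Nat.le_of_succ_le hjk) ((L : ℤ) • z) κ).2.2.2.2
    rw [Pi.add_apply, Pi.add_apply, linCovIter_succ, linCovIter_succ, linCovIter_succ, ih (Nat.le_of_succ_le hjk)]
    exact linQcov_add L _ _ _ _ κ hW

include hL hG hU₀ hα hα3 hα4 h52 in
/-- … and `ℂ`-HOMOGENEOUS (`linQcov_smul` at every level background). [cite: Balaban1985Averaging, p.38 (before (133)), (122) p.36] -/
theorem linCovIter_smul (t : ℂ) (B : B7Prop1Explicit.Site d → Fin d → 𝔸) :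
    ∀ j ≤ k, linCovIter L U₀ (t • B) j = t • linCovIter L U₀ B j := by
  intro j
  induction j with
  | zero => intro _; rfl
  | succ j ih =>
    intro hjk
    funext z κ
    have hW := (level_loop L hL hG k U₀ hU₀ hα hα3 hα4 h52 j (Nat.le_of_succ_le hjk) ((L : ℤ) • z) κ).2.2.2.2
    rw [Pi.smul_apply, Pi.smul_apply, linCovIter_succ, linCovIter_succ, ih (Nat.le_of_succ_le hjk)]
    exact linQcov_smul L _ t _ _ κ hW

include hL hG hU₀ hα hα3 hα4 h52 in
/-- **(126) ITERATED, NO SMALLNESS ON THE FIELD**: «|(Q(V₀)A)_c| ≦ (1 + O(1)L²α₀)|A|» at every level gives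
`‖LʲηQ_j(U₀)B‖ ≤ ∏_{i<j}(1 + O1cov·L²·2α₀(Lⁱ/Lᵏ)²)·Lʲ·sup‖B‖` (`h3lin_discharge` at the level backgrounds).
[cite: Balaban1985Averaging, (126) p.36, (128)–(131) pp.37–38] -/
theorem norm_linCovIter_le (B : B7Prop1Explicit.Site d → Fin d → 𝔸) {b : ℝ} (hb : 0 ≤ b) (hB : ∀ x κ, ‖B x κ‖ ≤ b) :
    ∀ j ≤ k, ∀ z κ, ‖linCovIter L U₀ B j z κ‖ ≤
      (∏ i ∈ range j, (1 + O1cov d * (L : ℝ) ^ 2 * (2 * (α₀ * ((L : ℝ) ^ i * ((L : ℝ) ^ k)⁻¹) ^ 2)))) *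
        ((L : ℝ) ^ j * b) := by
  have hL1 : 1 ≤ L := le_trans (by norm_num) hL
  intro j
  induction j with
  | zero => intro _ z κ; simpa using hB z κ
  | succ j ih =>
    intro hjk z κ
    have hj : j ≤ k := Nat.le_of_succ_le hjk
    obtain ⟨hV₀, hβ0, hβ, hβmax, -⟩ := level_loop L hL hG k U₀ hU₀ hα hα3 hα4 h52 j hj ((L : ℤ) • z) κ
    have hPj0 : 0 ≤ ∏ i ∈ range j, (1 + O1cov d * (L : ℝ) ^ 2 * (2 * (α₀ * ((L : ℝ) ^ i * ((L : ℝ) ^ k)⁻¹) ^ 2))) :=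
      prod_nonneg fun i _ => by have := O1cov_pos d; positivity
    have h := h3lin_discharge hL1 (le_refl (U1 𝔸)) (avgIter L U₀ j) _ hV₀ hβ0 hβ hβmax (linCovIter L U₀ B j)
      ((∏ i ∈ range j, (1 + O1cov d * (L : ℝ) ^ 2 * (2 * (α₀ * ((L : ℝ) ^ i * ((L : ℝ) ^ k)⁻¹) ^ 2)))) *
        ((L : ℝ) ^ j * b)) (mul_nonneg hPj0 (by positivity)) (ih hj) ((L : ℤ) • z) κ
    rw [linCovIter_succ, prod_range_succ]
    refine h.trans (le_of_eq ?_)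
    rw [pow_succ]; ring

include hL hG hU₀ hα hα3 hα4 h52 in
/-- **«LᵏηQ_k(U₀)» IS A BOUNDED LINEAR MAP `𝔸^S → 𝔸^{S′}` WITH `‖LᵏηQ_k(U₀)(ηA)‖ ≤ (3/2)‖A‖`, k-UNIFORM** (under print's
bracket «O(1)α₀ ≦ 1/6»: `∏(1 + κ_i) ≤ e^{4·O1cov·α₀} ≤ 3/2`); hence `ℂ`-differentiable everywhere.
[cite: Balaban1985Averaging, (126) p.36, (131) p.38, (143) p.39] -/
theorem isBoundedLinearMap_landauLin (hα6 : 4 * O1cov d * α₀ ≤ 1 / 3)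
    (S S' : Finset (B7Prop1Explicit.Site d × Fin d)) :
    IsBoundedLinearMap ℂ (landauLin L U₀ k S S') ∧ ∀ A : S → 𝔸, ‖landauLin L U₀ k S S' A‖ ≤ 3 / 2 * ‖A‖ := by
  have hL1 : 1 ≤ L := le_trans (by norm_num) hL
  have hLr : (2 : ℝ) ≤ L := by exact_mod_cast hL
  have hexp : Real.exp (4 * O1cov d * α₀) ≤ 3 / 2 :=
    (smallness_of_bracket (d := d) (t := 0) hα hα6 le_rfl (by norm_num)).1
  have hbound : ∀ A : S → 𝔸, ‖landauLin L U₀ k S S' A‖ ≤ 3 / 2 * ‖A‖ := by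
    intro A
    refine (pi_norm_le_iff_of_nonneg (by positivity)).2 fun c => ?_
    have h := norm_linCovIter_le L hL hG k U₀ hU₀ hα hα3 hα4 h52 (scaleIns L k S A) (b := ((L : ℝ) ^ k)⁻¹ * ‖A‖)
      (by positivity) (norm_scaleIns_le L k S A) k le_rfl c.1.1 c.1.2
    have hP := levelFactors_prod_le_exp hLr (O1cov_pos d).le hα.le k
    rw [pow_mul_inv_mul hL1] at h
    refine h.trans ?_
    have h0 : 0 ≤ ‖A‖ := norm_nonneg A
    calc (∏ i ∈ range k, (1 + O1cov d * (L : ℝ) ^ 2 * (2 * (α₀ * ((L : ℝ) ^ i * ((L : ℝ) ^ k)⁻¹) ^ 2)))) * ‖A‖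
        ≤ Real.exp (4 * O1cov d * α₀) * ‖A‖ := mul_le_mul_of_nonneg_right hP h0
      _ ≤ 3 / 2 * ‖A‖ := mul_le_mul_of_nonneg_right hexp h0
  refine ⟨⟨⟨fun A A' => ?_, fun t A => ?_⟩, 3 / 2, by norm_num, hbound⟩, hbound⟩
  · funext c
    simp only [landauLin, Pi.add_apply, scaleIns_add]
    rw [linCovIter_add L hL hG k U₀ hU₀ hα hα3 hα4 h52 _ _ k le_rfl, Pi.add_apply, Pi.add_apply]
  · funext c
    simp only [landauLin, Pi.smul_apply, scaleIns_smul]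
    rw [linCovIter_smul L hL hG k U₀ hU₀ hα hα3 hα4 h52 t _ k le_rfl, Pi.smul_apply, Pi.smul_apply]

end LinearPart

/-! ## §3 END-II's binder pair for `Cf := C_k(U₀, ·)`, k-uniform -/

section Binders

variable (L : ℕ) (hL : 2 ≤ L) {G : Subgroup 𝔸ˣ} (hG : AvgClosed d L G) (k : ℕ)
  (U₀ : B7Prop1Explicit.Site d → Fin d → 𝔸ˣ) (hU₀ : ∀ x κ, U₀ x κ ∈ G) {α₀ : ℝ} (hα : 0 < α₀)
  (hα3 : C0 d * α₀ ≤ 1 / 3) (hα4 : 4 * α₀ ≤ c2' d L) (hα6 : 4 * O1cov d * α₀ ≤ 1 / 3)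
  (h52 : pdev U₀ < α₀ * (((L : ℝ) ^ k)⁻¹) ^ 2) (S S' : Finset (B7Prop1Explicit.Site d × Fin d))

omit [NormedAlgebra ℂ 𝔸] [CompleteSpace 𝔸] [NormOneClass 𝔸] in
include hL hα hα6 in
/-- the hypotheses of `prop4_general_bounds` ∕ `prop4_general_analyticAt` at the scaled insertion of a field `A` with
`‖A‖ ≤ landauRad d L`, in the currency `b = L^{−k}‖A‖` (`Lᵏb = ‖A‖`). [folklore] -/
private theorem hyps_of_le_rad {A : S → 𝔸} (hA : ‖A‖ ≤ landauRad d L) :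
    Real.exp (4 * O1cov d * α₀) * (1 + 8 * C1cov d * ((L : ℝ) ^ k * (((L : ℝ) ^ k)⁻¹ * ‖A‖))) ≤ 2 ∧
      2 * ((L : ℝ) ^ k * (((L : ℝ) ^ k)⁻¹ * ‖A‖)) ≤ c3 d L ∧ Real.exp (4 * O1cov d * α₀) ≤ 3 / 2 := by
  have hL1 : 1 ≤ L := le_trans (by norm_num) hL
  rw [pow_mul_inv_mul hL1]
  obtain ⟨h8, hc₃⟩ := bracket_of_le_landauRad (d := d) hA
  obtain ⟨hexp, hsmall⟩ := smallness_of_bracket (d := d) hα hα6 (norm_nonneg A) h8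
  exact ⟨hsmall, hc₃, hexp⟩

include hL hG hU₀ hα hα3 hα4 hα6 h52 in
/-- **(135) IN THE `A`-CURRENCY, k-UNIFORM — END-II's `hCq`**: `‖C_k(U₀, A)‖_{S′} ≤ C2cov(d)·‖A‖²_S` for `‖A‖_S ≤ landauRad(d,L)`
(`prop4_general_bounds` (130) at `j = k` with `b = L^{−k}‖A‖`, `Lᵏb = ‖A‖`, and `e^{4·O1cov·α₀} ≤ 3/2`).
[cite: Balaban1985Averaging, Proposition 4 (135) pp.38–39; Balaban1985Variational, (44) p.285] -/
theorem norm_landauCf_le {A : S → 𝔸} (hA : ‖A‖ ≤ landauRad d L) :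
    ‖landauCf L U₀ k S S' A‖ ≤ C2cov d * ‖A‖ ^ 2 := by
  have hL1 : 1 ≤ L := le_trans (by norm_num) hL
  obtain ⟨hsmall, hc₃, hexp⟩ := hyps_of_le_rad L hL k hα hα6 S hA
  have hbd := (prop4_general_bounds L hL hG k U₀ hU₀ hα hα3 hα4 h52 (scaleIns L k S A) (by positivity)
    (norm_scaleIns_le L k S A) hsmall hc₃ k le_rfl).1
  rw [pow_mul_inv_mul hL1] at hbd
  have hC := C1cov_pos d
  have hC2 : 0 ≤ C2cov d := by unfold C2cov; positivity
  have h0 : 0 ≤ ‖A‖ ^ 2 := sq_nonneg _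
  refine (pi_norm_le_iff_of_nonneg (mul_nonneg hC2 h0)).2 fun c => (hbd c.1.1 c.1.2).trans ?_
  have h12 : 8 * C1cov d * Real.exp (4 * O1cov d * α₀) ≤ C2cov d := by unfold C2cov; nlinarith
  exact mul_le_mul_of_nonneg_right h12 h0

include hL hG hU₀ hα hα3 hα4 hα6 h52 in
/-- **«Q_k(U₀, ηA, c) … is an analytic function of the variables A_b» ON `𝔸^S` — the composite part**: for `‖A₀‖ <
landauRad`, `A ↦ Q_k(U₀, ηA)(c)` is analytic at `A₀` (`prop4_general_analyticAt` with the parameter space `E := 𝔸^S` and the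
analytic family `A ↦ scaleIns A`). [cite: Balaban1985Averaging, Proposition 4 p.38, (127) p.37] -/
theorem analyticAt_logCovIter_scaleIns {A₀ : S → 𝔸} (hA : ‖A₀‖ < landauRad d L) (z : B7Prop1Explicit.Site d)
    (κ : Fin d) : AnalyticAt ℂ (fun A : S → 𝔸 => logCovIter L U₀ (scaleIns L k S A) k z κ) A₀ := by
  obtain ⟨hsmall, hc₃, -⟩ := hyps_of_le_rad L hL k hα hα6 S hA.le
  have hBan : ∀ x κ', AnalyticAt ℂ (fun A : S → 𝔸 => scaleIns L k S A x κ') A₀ := by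
    intro x κ'
    have h : (fun A : S → 𝔸 => scaleIns L k S A x κ') = fun A => (((L : ℂ) ^ k)⁻¹) • insCfg S A x κ' := by
      funext A; simp only [scaleIns, insCfg_smul, Pi.smul_apply]
    rw [h]
    exact (analyticAt_const : AnalyticAt ℂ (fun _ : S → 𝔸 => (((L : ℂ) ^ k)⁻¹ : ℂ)) A₀).smul
      (analyticAt_insCfg S x κ' A₀)
  exact prop4_general_analyticAt L hL hG k U₀ hU₀ hα hα3 hα4 h52 (fun A : S → 𝔸 => scaleIns L k S A) A₀ hBan
    (by positivity) (norm_scaleIns_le L k S A₀) hsmall hc₃ k le_rfl z κ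

include hL hG hU₀ hα hα3 hα4 hα6 h52 in
/-- **END-II's `hCd`**: `C_k(U₀, ·)` is `ℂ`-differentiable on the ball `‖A‖ < landauRad(d,L)` of `𝔸^S` (the composite part is
analytic componentwise, the composed linear part is a bounded linear map). [cite: Balaban1985Averaging, Proposition 4 p.38] -/
theorem differentiableOn_landauCf : DifferentiableOn ℂ (landauCf L U₀ k S S') (ball 0 (landauRad d L)) := by
  have hlin := (isBoundedLinearMap_landauLin L hL hG k U₀ hU₀ hα hα3 hα4 h52 hα6 S S').1.differentiable
  have heq : landauCf L U₀ k S S' = fun A => (fun c : S' => logCovIter L U₀ (scaleIns L k S A) k c.1.1 c.1.2)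
      - landauLin L U₀ k S S' A := by
    funext A c; rfl
  rw [heq]
  refine DifferentiableOn.sub (fun A hA => ?_) hlin.differentiableOn
  have hA' : ‖A‖ < landauRad d L := by simpa using hA
  have han : AnalyticAt ℂ (fun A : S → 𝔸 => fun c : S' => logCovIter L U₀ (scaleIns L k S A) k c.1.1 c.1.2) A :=
    analyticAt_pi_iff.2 fun c => analyticAt_logCovIter_scaleIns L hL hG k U₀ hU₀ hα hα3 hα4 hα6 h52 S hA' c.1.1 c.1.2
  exact han.differentiableAt.differentiableWithinAt

include hL hG hU₀ hα hα3 hα4 hα6 h52 in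
/-- **W-a (Cf) JUNCTION — END-II's LANDAU-CORRECTION BINDER PAIR FOR B7's `C_k(U₀, ·)`, k-UNIFORM.**  For `L ≥ 2`, `U₀`
as in Prop. 2 (`G`-valued, `AvgClosed d L G`, `pdev U₀ < α₀L^{−2k}`, `C₀α₀ ≤ 1/3`) with `4α₀ ≤ c₂′(d,L)` and
`4·O1cov(d)·α₀ ≤ 1/3`, and ANY finite bond sets `S` (variables) and `S′` (`Lᵏ`-bonds read): with `Cf := landauCf L U₀ k S S'
: 𝔸^S → 𝔸^{S′}`, `C₂ := C2cov d = 12·131072(d+1)²`, `RC := landauRad d L = min(1/(24·C1cov d), c₃(d,L)/2)` —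
`hCq : ∀ A, ‖A‖ < RC → ‖Cf A‖ ≤ C₂‖A‖²` and `hCd : DifferentiableOn ℂ Cf (ball 0 RC)`, the exact shapes of
`ShellMeasureLandauHolonomyPrint.slotAC_realized_su2_landauChart_print`'s binders (per exterior section: take `U₀` the
section's datum — `C₂`, `RC` do not see it).  [Balaban1985Variational] (44)'s `Q_j(LʲηA′) = LʲηQ_jA′ + C_j(LʲηA′)` on `Ω_j`
is this statement up to the `Lʲη`-scaling display, W-c [dict] and the `Ω_j` geometry — SAID, not claimed.
[cite: Balaban1985Averaging, Proposition 4 (134)–(135) pp.38–39; Balaban1985Variational, (44) p.285] -/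
theorem landauCorrection_binders :
    (∀ A : S → 𝔸, ‖A‖ < landauRad d L → ‖landauCf L U₀ k S S' A‖ ≤ C2cov d * ‖A‖ ^ 2) ∧
      DifferentiableOn ℂ (landauCf L U₀ k S S') (ball 0 (landauRad d L)) :=
  ⟨fun _ hA => norm_landauCf_le L hL hG k U₀ hU₀ hα hα3 hα4 hα6 h52 S S' hA.le,
    differentiableOn_landauCf L hL hG k U₀ hU₀ hα hα3 hα4 hα6 h52 S S'⟩

include hL hG hU₀ hα hα3 hα4 hα6 h52 in
/-- the same in B13's line-analytic form `QuadAnalytic Cf C₂ RC` (`ShellMeasureLandauFixedPoint.quadAnalytic_of_frechet`), the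
input TYPE of `B13Contraction113.analytic_fixedPoint_113` ∕ `ShellMeasureLandauFixedPoint.landauCorrection_along`.
[cite: Balaban1985Variational, (44) p.285, (50)–(55) p.286] -/
theorem landauCorrection_quadAnalytic : QuadAnalytic (landauCf L U₀ k S S') (C2cov d) (landauRad d L) :=
  quadAnalytic_of_frechet (landauCorrection_binders L hL hG k U₀ hU₀ hα hα3 hα4 hα6 h52 S S').1
    (landauCorrection_binders L hL hG k U₀ hU₀ hα hα3 hα4 hα6 h52 S S').2

include hL hG hU₀ hα hα3 hα4 hα6 h52 in
/-- **`Cf` IS THE PRINTED `C_k` OF THE ITERATE ITSELF**: on the ball and for `k ≥ 1`, at every `Lᵏ`-bond `c ∈ S′`,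
`landauCf A (c) = (1/i) log U̿₁ᵏ(c) − LᵏηQ_k(U₀)(ηA)(c)` where `U̿₁ᵏ = dbavgCovIter L U₀ (e^{ηA on S}) k` is the k-th order
average (90)/(91) (`mlog_dbavgCovIter`: on the ball the logarithm of the iterate IS the composite (127)).
[cite: Balaban1985Averaging, Proposition 4 (134) p.38, (127) p.37, (90)–(91) p.31] -/
theorem landauCf_eq_mlog_sub {j : ℕ} (hk : k = j + 1) {A : S → 𝔸} (hA : ‖A‖ < landauRad d L) (c : S') :
    landauCf L U₀ k S S' A c
      = mlog ((dbavgCovIter L U₀ (expCfg (scaleIns L k S A)) k c.1.1 c.1.2 : 𝔸ˣ) : 𝔸)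
        - landauLin L U₀ k S S' A c := by
  subst hk
  obtain ⟨hsmall, hc₃, -⟩ := hyps_of_le_rad L hL (j + 1) hα hα6 S hA.le
  rw [mlog_dbavgCovIter L hL hG (j + 1) U₀ hU₀ hα hα3 hα4 h52 (scaleIns L (j + 1) S A) (by positivity)
    (norm_scaleIns_le L (j + 1) S A) hsmall hc₃ le_rfl]
  rfl

end Binders

end Summit.QuantumFields.BalabanUV.T4Continuum.ShellMeasureLandauCorrectionB7

end
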